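import Literature.NumberTheory.Automorphic.PairLFunctionNeConjGlobalRankinSelberg
import Literature.NumberTheory.Automorphic.PairLFunctionMeromorphicContinuationNeConjOneFamily
import Literature.NumberTheory.Automorphic.RankinSelbergIntegralEntireZero
import HarnessLib

/-!
# Mœglin–Waldspurger, Corollaire (i)(b) — `L^S(s, π × σ)` is entire for `π ≇ σ̃` — from the LOCAL
Rankin–Selberg theory (and, for the pairs with `ω_π ω_σ ≠ 1`, an explicit hypothesis)

Topic `NumberTheory/Automorphic`; namespace `Literature.NumberTheory.Automorphic`. Proof file (theorems
only: no definition, no named fact, no instance) under the named fact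
`MoeglinWaldspurger1989_partialPairL_entire_of_ne_conj` (`PairLFunctionMeromorphicContinuation`;
Mœglin–Waldspurger (1989), Appendice, Corollaire (i)(b), p. 667). The printed proof is the global
Rankin–Selberg method for the pair `(π, σ̄)` (Jacquet–Shalika (1981), §4; Cogdell (2004), §2.3 and
§4.2, proof of Thm. 4.2): `I(s; φ, φ', Φ)` is entire but for simple poles at `s = 0, 1`, it unfolds and
factors as `I(s) = C · L^{S'}(s, π × σ) · Ψ_{S'}(s)`, both residues vanish for `π ≇ σ̃`, and by the LOCAL
theory finitely many data realise at the places of `S'` (and at infinity) exactly the local `L`-factors,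
whose reciprocals are entire — so that `L^{S₀}(s, π × σ) · (∏_{v ∈ S₀ ∪ ∞} L_v(s))` is a finite sum of
global integrals, entire, and `L^{S₀}` is entire. The tree contains the whole GLOBAL half, proved in the
honest `L²` model for every `n ≥ 1` (`PairLFunctionNeConjGlobalRankinSelberg`:
`exists_entire_eq_mul_partialPairL_mul_setIntegral_pair`), including BOTH residues: at `s = 1` by the
orthogonality of inequivalent cuspidal representations, and at `s = 0` by the `g`-independence of the
residue of the mirabolic Eisenstein series (`RankinSelbergIntegralEntireZero`;
`apply_zero_eq_zero_of_entire_eq_mul_rankinSelbergIntegral_of_ne_conj` below — no functional equation is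
needed).

`MoeglinWaldspurger1989_partialPairL_entire_of_ne_conj_of_local` derives the named fact from two
explicit inputs, which are exactly what the tree does not contain:

* `hloc` — **the local Rankin–Selberg theory**, for the pairs `π ≠ σ̄` on which the centre acts through
  a common unitary character on `π` and on `σ̄` (hypothesis `hω`: `ω_π = ω_{σ̄}`, i.e. `ω_π ω_σ = 1` — the
  only pairs the trivial-character mirabolic Eisenstein series of the tree can see): for every finite
  `S₀` carrying Satake families `α`, `β` there are finitely many data of the method — `f_i ∈ π`,
  `f'_i ∈ σ̄`, levels `𝔫_i`, test functions `η_i` of level `K(𝔫_i)`, finite `S'_i ⊇ S₀` off which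
  `v ∤ 𝔫_i 𝔡_K`, enumerations of `α`, `β̄` off `S'_i`, standard Schwartz–Bruhat `Φ_i = Φ_{i,∞} ⊗ 𝟙` —
  and coefficients `c_i` such that the sum of the normalised `S'`-parts
  `∑_i c_i (∏_{v ∈ S'_i ∖ S₀} det(1 - A_v ⊗ B_v q_v^{-s})) Ψ_{S'_i}(s)` has, on the strip `1 < re s < 2`,
  a reciprocal which extends to an ENTIRE function `B` (Jacquet–Piatetski-Shapiro–Shalika (1983), §2,
  Thm. 2.7 and Jacquet–Shalika (1981), §1, §3: the local integrals at the finitely many places of `S'`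
  and at infinity realise, after summing over finitely many data, the local `L`-factor, and
  `1 / L_v(s, π_v × σ̄_v)` is entire — a polynomial in `q_v^{-s}` at a finite place, a reciprocal Gamma
  product at an infinite one; so `B = ∏ 1/L_v` for data realising the `L`-factors). No local integral is
  asked to be entire;
* `htw` — for the pairs `π ≠ σ̄` WITHOUT a common central action (`ω_π ω_σ ≠ 1`) the conclusion itself:
  there the printed proof runs the same method with the `ω_π ω_σ`-twisted Eisenstein series
  `E(g, Φ; s, η)` (Cogdell, §2.3), which the tree does not have, and the untwisted integrals vanish
  identically; this input is therefore stated as what it must deliver, visibly.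

Proof: for a pair with `hω`, take the data of `hloc` at the ramified set `S₀`; the global theorem gives
entire `F_i` with `F_i = s (s - 1) · C · A_i · L^{S₀}` on the strip
(`partialPairL_eq_prod_mul_partialPairL` moves the unramified factors of `S'_i ∖ S₀`), `F_i(1) = 0` and
`F_i(0) = 0`; hence `G = C⁻¹ B ∑ c_i F_i` is entire, vanishes at `0` and `1`, and equals
`s (s - 1) L^{S₀}` on the strip, so on `re s > 1` (identity theorem); the removable-poles lemma and the
one-family reduction (`PairLFunctionMeromorphicContinuationNeConjOneFamily`) conclude. For a pair without
`hω`, `htw` is the one-family datum.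

## References

* C. Mœglin, J.-L. Waldspurger, *Le spectre résiduel de GL(n)*, Ann. Sci. ÉNS 22 (1989), Appendice,
  Corollaire (i)(b), p. 667 [MoeglinWaldspurger1989].
* J. W. Cogdell, *Analytic theory of L-functions for GL_n*, in *An Introduction to the Langlands
  Program* (2004), §2.3, §3, §4.2 [CogdellAnalyticTheory2004].
* H. Jacquet, J. A. Shalika, *On Euler products and the classification of automorphic
  representations I, II*, Amer. J. Math. 103 (1981), I §4 Lemma 4.2, II Prop. 3.6 [JacquetShalikaAJM1981].
-/

noncomputable section

open MeasureTheory Measure NumberField IsDedekindDomain Matrix Set Filter Topology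
open scoped ENNReal NNReal ComplexConjugate

namespace Literature.NumberTheory.Automorphic

open Literature.NumberTheory.GaloisRepresentations (ideleGroup)

-- the automorphic quotient carries the tree's Borel σ-algebra, not Mathlib's quotient σ-algebra
-- (verbatim from `RankinSelbergUnfoldingIdentity`)
attribute [-instance] Quotient.instMeasurableSpace QuotientGroup.measurableSpace

section LocalReduction

open ValuativeRel

variable {n : ℕ} {K : Type} [Field K] [NumberField K]
variable {μ' : Measure (AdelicGroupData.gl n K).automorphicQuotient} [(AdelicGroupData.gl n K).IsAutomorphicMeasure μ']
variable [MeasurableSpace (AdeleRing (𝓞 K) K)] [BorelSpace (AdeleRing (𝓞 K) K)]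

-- the house local instances, exactly as in `RankinSelbergUnfoldingIdentity`
attribute [local instance] adelicBorel borelSpace_adelic locallyCompactSpace_adelic secondCountableTopology_gl_adelic
  glAdeleBorel borelSpace_glAdele borelSpace_ideleGroup secondCountableTopology_ideleGroup

omit [NumberField K] in
/-- `\bar{\bar{m}} = m` for a multiset of complex numbers. [folklore] -/
theorem multiset_map_conj_map_conj (m : Multiset ℂ) : (m.map conj).map conj = m := by
  rw [Multiset.map_map]
  conv_rhs => rw [← Multiset.map_id m]
  exact Multiset.map_congr rfl fun z _ => Complex.conj_conj z

omit [MeasurableSpace (AdeleRing (𝓞 K) K)] [BorelSpace (AdeleRing (𝓞 K) K)] in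
/-- **Equality on the strip propagates to the half-plane `re s > 1`** for an entire `F` and
`A · L^{S}(·, α ⊗ β)` with `A` entire and `α`, `β` Satake families of a cuspidal pair (`L^S` is
holomorphic on `re s > 1`, `differentiableOn_partialPairL_of_isSatakeFamilyOf`; identity theorem on the
connected half-plane). [folklore] -/
theorem eq_mul_partialPairL_of_eqOn_strip (P P' : CuspidalAutomorphicRepGL n K μ')
    {S : Set (HeightOneSpectrum (𝓞 K))} {α β : SatakeFamily K}
    (hα : IsSatakeFamilyOf P S α) (hβ : IsSatakeFamilyOf P' S β)
    {F A : ℂ → ℂ} (hF : Differentiable ℂ F) (hA : Differentiable ℂ A)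
    (h : ∀ s : ℂ, 1 < s.re → s.re < 2 → F s = A s * partialPairL S α β s) :
    ∀ s : ℂ, 1 < s.re → F s = A s * partialPairL S α β s := by
  set U : Set ℂ := {z : ℂ | 1 < z.re} with hU
  have hUo : IsOpen U := isOpen_lt continuous_const Complex.continuous_re
  have hUc : IsPreconnected U := (convex_halfSpace_re_gt (1 : ℝ)).isPreconnected
  have hL : DifferentiableOn ℂ (partialPairL S α β) U :=
    differentiableOn_partialPairL_of_isSatakeFamilyOf P P' hα hβ
  have hJ : AnalyticOnNhd ℂ F U := hF.differentiableOn.analyticOnNhd hUo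
  have hR : AnalyticOnNhd ℂ (fun z => A z * partialPairL S α β z) U :=
    (hA.differentiableOn.mul hL).analyticOnNhd hUo
  have hz₀ : ((3 / 2 : ℝ) : ℂ) ∈ U := by
    simp only [hU, Set.mem_setOf_eq, Complex.ofReal_re]; norm_num
  have hev : F =ᶠ[𝓝 ((3 / 2 : ℝ) : ℂ)] fun z => A z * partialPairL S α β z := by
    have hmem : {z : ℂ | 1 < z.re ∧ z.re < 2} ∈ 𝓝 ((3 / 2 : ℝ) : ℂ) := by
      refine ((isOpen_lt continuous_const Complex.continuous_re).inter
        (isOpen_lt Complex.continuous_re continuous_const)).mem_nhds ?_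
      simp only [Set.mem_inter_iff, Set.mem_setOf_eq, Complex.ofReal_re]; norm_num
    filter_upwards [hmem] with z hz
    exact h z hz.1 hz.2
  intro s hs
  exact hJ.eqOn_of_preconnected_of_eventuallyEq hR hUc hz₀ hev hs

/-! ### The residue at `s = 0` vanishes for `π ≠ σ̄` -/

/-- **The residue of `I(s; S̄_η f', S_η f, Φ)` at `s = 0` vanishes for `π ≠ σ̄`** (`f ∈ π`, `f' ∈ σ̄`,
multiplicity one): every entire `F` with `F(s) = s (s - 1) I(s)` for `re s > 1` has `F(0) = 0`. Indeed `F`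
is the continuation of `RankinSelbergIntegralEntireZero` (uniqueness, `eq_of_differentiable_of_eqOn_one_lt_re`),
whose value at `0` is `V Φ(0)/n · ∫ S̄_η f' S_η f dμ'`, and `∫ S̄_η f' S_η f = 0` because `[S̄_η f'] ∈ σ`,
`[S_η f] ∈ π` and `σ ≠ π̄` (`integral_mul_eq_zero_of_ne_conj`). Jacquet–Shalika (1981), §4, Lemma 4.2 (the
residue of `E(g, Φ; s)` at `s = 0` is `-V Φ(0)/n`, independent of `g`); Cogdell (2004), §4.2.
[cite: JacquetShalikaAJM1981, §4, Lemma 4.2] [cite: CogdellAnalyticTheory2004, §4.2 (proof of Thm. 4.2)] -/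
theorem apply_zero_eq_zero_of_entire_eq_mul_rankinSelbergIntegral_of_ne_conj (hn : 0 < n)
    (h₁ : multiplicity_one_gl n K μ') (νI : Measure (ideleGroup K)) [νI.IsHaarMeasure]
    (P P' : CuspidalAutomorphicRepGL n K μ') (hne : P ≠ P'.conj)
    (f : P.1.toSubmodule) (f' : P'.conj.1.toSubmodule)
    {η : (AdelicGroupData.gl n K).Adelic → ℝ} (hη : IsTestFunctionGL n K η)
    {Φ : (Fin n → AdeleRing (𝓞 K) K) → ℂ} (hΦ : Φ ∈ piSchwartzBruhat K (Fin n))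
    {F : ℂ → ℂ} (hF : Differentiable ℂ F)
    (hFI : ∀ s : ℂ, 1 < s.re → F s = s * (s - 1) * rankinSelbergIntegral μ' νI Φ s
      (star (smoothedForm η (f' : (AdelicGroupData.gl n K).L2 μ')))
      (smoothedForm η (f : (AdelicGroupData.gl n K).L2 μ'))) :
    F 0 = 0 := by
  classical
  haveI hνIR : νI.IsMulRightInvariant := by
    haveI := isInvInvariant_of_isHaarMeasure_ideleGroup (K := K) νI
    infer_instance
  -- the datum
  set φt : (AdelicGroupData.gl n K).automorphicQuotient → ℂ :=
    smoothedForm η (f : (AdelicGroupData.gl n K).L2 μ') with hφt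
  set φt' : (AdelicGroupData.gl n K).automorphicQuotient → ℂ :=
    smoothedForm η (f' : (AdelicGroupData.gl n K).L2 μ') with hφt'
  have hφtc : Continuous φt := continuous_smoothedForm hη.continuous hη.hasCompactSupport _
  have hφt'c : Continuous φt' := continuous_smoothedForm hη.continuous hη.hasCompactSupport _
  have hφd : IsRapidlyDecreasingGL n K (invQuot (AdelicGroupData.gl n K) φt) :=
    isRapidlyDecreasingGL_invQuot_smoothedForm hη (P.2.1 f.2)
  have hφ'd : IsRapidlyDecreasingGL n K (invQuot (AdelicGroupData.gl n K) (star φt')) :=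
    isRapidlyDecreasingGL_invQuot_star (isRapidlyDecreasingGL_invQuot_smoothedForm hη (P'.conj.2.1 f'.2))
  -- the explicit continuation and its value at `0`
  obtain ⟨F₀, hF₀, hF₀I, hF₀0⟩ := exists_entire_eq_mul_rankinSelbergIntegral_apply_zero (K := K) νI hn μ' hΦ
    (show Continuous (star φt') from continuous_star.comp hφt'c) hφtc hφ'd hφd
  have hFF₀ : F = F₀ :=
    eq_of_differentiable_of_eqOn_one_lt_re hF hF₀ fun s hs => by rw [hFI s hs, hF₀I s hs]
  -- `∫ φ̄' φ = 0`: `[φ̄'] ∈ σ`, `[φ] ∈ π`, `σ ≠ π̄`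
  have hφm : φt ∈ cuspForms n K μ' := smoothedForm_mem_cuspForms P hη.continuous hη.hasCompactSupport f
  have hφ'm : φt' ∈ cuspForms n K μ' := smoothedForm_mem_cuspForms P'.conj hη.continuous hη.hasCompactSupport f'
  have hP : cuspFormsToLp n K μ' ⟨φt, hφm⟩ ∈ P.1 :=
    cuspFormsToLp_smoothedForm_mem P hη.continuous hη.hasCompactSupport f
  have hQ' : cuspFormsToLp n K μ' ⟨star φt', star_mem_cuspForms μ' hφ'm⟩ ∈ P'.conj.conj.1 :=
    cuspFormsToLp_star_mem_conj P'.conj hφ'm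
      (cuspFormsToLp_smoothedForm_mem P'.conj hη.continuous hη.hasCompactSupport f')
  rw [CuspidalAutomorphicRepGL.conj_conj] at hQ'
  have hne' : P' ≠ P.conj := fun h' => hne (CuspidalAutomorphicRepGL.conj_eq_iff_eq_conj.1 h'.symm)
  have h0 : ∫ x, (star φt') x * φt x ∂μ' = 0 :=
    integral_mul_eq_zero_of_ne_conj h₁ P' P hne' (star_mem_cuspForms μ' hφ'm) hφm hQ' hP
  rw [hFF₀, hF₀0, h0, mul_zero]

/-- **Mœglin–Waldspurger, Corollaire (i)(b), from the local Rankin–Selberg theory.** The named fact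
`MoeglinWaldspurger1989_partialPairL_entire_of_ne_conj` — `L^S(s, π × σ)` extends to an entire function
for all cuspidal `π`, `σ` on `GL_n(𝔸_K)` (`n ≥ 1`, multiplicity one on `L²_cusp`) with `π ≠ σ̄` — follows
from the global Rankin–Selberg theorems of the tree together with the two inputs `hloc` (the local
theory, for the pairs with a common central action `hω`: finitely many data whose normalised `S'`-parts
sum, on the strip, to a function with an ENTIRE reciprocal `B`) and `htw` (the conclusion for the pairs
without a common central action, where the printed proof needs the twisted Eisenstein series) — see the
module docstring. Both residues of the global integrals are theorems (`F_i(1) = 0`: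
`exists_entire_eq_mul_partialPairL_mul_setIntegral_pair`; `F_i(0) = 0`:
`apply_zero_eq_zero_of_entire_eq_mul_rankinSelbergIntegral_of_ne_conj`).
[cite: MoeglinWaldspurger1989, Appendice, Corollaire (i)(b), p. 667] [cite: CogdellAnalyticTheory2004, §4.2 (proof of Thm. 4.2)] -/
theorem MoeglinWaldspurger1989_partialPairL_entire_of_ne_conj_of_local
    (νI : Measure (ideleGroup K)) [νI.IsHaarMeasure]
    (νA : Measure (Fin n → ideleGroup K)) [IsHaarMeasure νA]
    (νK : Measure ↥(maximalCompactAdelic n K)) [IsHaarMeasure νK]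
    (ν₀ : Measure ↥(adelicUnipotent n K)) [IsHaarMeasure ν₀]
    (hloc : ∀ (_hn : 0 < n) (_h₁ : multiplicity_one_gl n K μ')
      (P P' : CuspidalAutomorphicRepGL n K μ') (_hne : P ≠ P'.conj)
      (_hω : (∀ z : ideleGroup K, ∃ c : ℂ, ‖c‖ = 1 ∧
        (∀ f : P.1.toSubmodule,
          (AdelicGroupData.gl n K).rightRegular μ' (Matrix.GeneralLinearGroup.scalar (Fin n) z)
              (f : (AdelicGroupData.gl n K).L2 μ') = c • (f : (AdelicGroupData.gl n K).L2 μ')) ∧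
        (∀ f' : P'.conj.1.toSubmodule,
          (AdelicGroupData.gl n K).rightRegular μ' (Matrix.GeneralLinearGroup.scalar (Fin n) z)
              (f' : (AdelicGroupData.gl n K).L2 μ') = c • (f' : (AdelicGroupData.gl n K).L2 μ'))))
      {S₀ : Set (HeightOneSpectrum (𝓞 K))} (_hS₀ : S₀.Finite) {α β : SatakeFamily K}
      (_hα : IsSatakeFamilyOf P S₀ α) (_hβ : IsSatakeFamilyOf P' S₀ β),
      ∃ (m : ℕ) (c : Fin m → ℂ) (f : Fin m → P.1.toSubmodule) (f' : Fin m → P'.conj.1.toSubmodule)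
        (𝔫₀ : Fin m → Ideal (𝓞 K)) (_h𝔫₀ : ∀ i, 𝔫₀ i ≠ 0)
        (η : Fin m → (AdelicGroupData.gl n K).Adelic → ℝ) (_hη : ∀ i, IsTestFunctionGL n K (η i))
        (_hηK : ∀ i, ∀ k : (AdelicGroupData.gl n K).Adelic, k ∈ principalCongruenceLevel n K (𝔫₀ i) →
          ∀ g : (AdelicGroupData.gl n K).Adelic, η i (k * g) = η i g)
        (S' : Fin m → Set (HeightOneSpectrum (𝓞 K))) (hS'f : ∀ i, (S' i \ S₀).Finite) (_hS₀S' : ∀ i, S₀ ⊆ S' i)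
        (_hS' : ∀ i, ∀ v ∉ S' i, ¬ v.asIdeal ∣ 𝔫₀ i ∧ ¬ v.asIdeal ∣ differentIdeal ℤ (𝓞 K))
        (x y : Fin m → HeightOneSpectrum (𝓞 K) → Fin n → ℂ)
        (_hx : ∀ i, ∀ v ∉ S' i, (Finset.univ : Finset (Fin n)).val.map (x i v) = α v)
        (_hy : ∀ i, ∀ v ∉ S' i, (Finset.univ : Finset (Fin n)).val.map (y i v) = (β v).map conj)
        (Φinf : Fin m → (Fin n → InfiniteAdeleRing K) → ℝ) (_hΦc : ∀ i, Continuous (Φinf i))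
        (_hΦ0 : ∀ i, ∀ z, 0 ≤ Φinf i z)
        (_hΦS : ∀ i, (fun v => ((standardTestFun n K (Φinf i) v : ℝ) : ℂ)) ∈ piSchwartzBruhat K (Fin n))
        (B : ℂ → ℂ), Differentiable ℂ B ∧
          ∀ s : ℂ, 1 < s.re → s.re < 2 →
            B s * (∑ i, c i * ((∏ v ∈ (hS'f i).toFinset,
                (satakePairPolynomial (α v) (β v)).eval ((v.residueCard : ℂ) ^ (-s))) *
              ∫ p in unitBox {v | v ∉ S' i} ×ˢ Set.univ, torusPairIntegrandC n K
                (whittakerCoeff ν₀ (unipotentTateDomain n K) (adeleAddChar K)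
                  (invQuot (AdelicGroupData.gl n K) (smoothedForm (η i) ((f i : P.1.toSubmodule) : (AdelicGroupData.gl n K).L2 μ'))))
                (star (whittakerCoeff ν₀ (unipotentTateDomain n K) (adeleAddChar K)
                  (invQuot (AdelicGroupData.gl n K) (smoothedForm (η i) ((f' i : P'.conj.1.toSubmodule) : (AdelicGroupData.gl n K).L2 μ')))))
                (standardTestFun n K (Φinf i)) s p ∂(νA.prod νK))) = 1)
    (htw : ∀ (_hn : 0 < n) (_h₁ : multiplicity_one_gl n K μ')
      (P P' : CuspidalAutomorphicRepGL n K μ') (_hne : P ≠ P'.conj)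
      (_hω : ¬ (∀ z : ideleGroup K, ∃ c : ℂ, ‖c‖ = 1 ∧
        (∀ f : P.1.toSubmodule,
          (AdelicGroupData.gl n K).rightRegular μ' (Matrix.GeneralLinearGroup.scalar (Fin n) z)
              (f : (AdelicGroupData.gl n K).L2 μ') = c • (f : (AdelicGroupData.gl n K).L2 μ')) ∧
        (∀ f' : P'.conj.1.toSubmodule,
          (AdelicGroupData.gl n K).rightRegular μ' (Matrix.GeneralLinearGroup.scalar (Fin n) z)
              (f' : (AdelicGroupData.gl n K).L2 μ') = c • (f' : (AdelicGroupData.gl n K).L2 μ'))))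
      {S₀ : Set (HeightOneSpectrum (𝓞 K))} (_hS₀ : S₀.Finite) {α β : SatakeFamily K}
      (_hα : IsSatakeFamilyOf P S₀ α) (_hβ : IsSatakeFamilyOf P' S₀ β),
      ∃ g : ℂ → ℂ, Differentiable ℂ g ∧ ∀ s : ℂ, 1 < s.re → g s = partialPairL S₀ α β s)
    :
    MoeglinWaldspurger1989_partialPairL_entire_of_ne_conj (n := n) (K := K) (μ := μ') := by
  classical
  refine MoeglinWaldspurger1989_partialPairL_entire_of_ne_conj_of_one_family fun hn h₁ P P' hne => ?_
  -- the ramified datum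
  obtain ⟨α₀, β₀, hα₀, hβ₀⟩ := exists_isSatakeFamilyOf_pair_ramified P P'
  have hS₀ : {v : HeightOneSpectrum (𝓞 K) | ¬ IsUnramifiedAt P.1 v ∨ ¬ IsUnramifiedAt P'.1 v}.Finite :=
    finite_setOf_not_isUnramifiedAt_or P P'
  set S₀ : Set (HeightOneSpectrum (𝓞 K)) := {v | ¬ IsUnramifiedAt P.1 v ∨ ¬ IsUnramifiedAt P'.1 v} with hS₀def
  refine ⟨S₀, α₀, β₀, fun v hv => hv, hα₀, hβ₀, ?_⟩
  -- pairs without a common central action: the twisted input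
  by_cases hω : (∀ z : ideleGroup K, ∃ c : ℂ, ‖c‖ = 1 ∧
        (∀ f : P.1.toSubmodule,
          (AdelicGroupData.gl n K).rightRegular μ' (Matrix.GeneralLinearGroup.scalar (Fin n) z)
              (f : (AdelicGroupData.gl n K).L2 μ') = c • (f : (AdelicGroupData.gl n K).L2 μ')) ∧
        (∀ f' : P'.conj.1.toSubmodule,
          (AdelicGroupData.gl n K).rightRegular μ' (Matrix.GeneralLinearGroup.scalar (Fin n) z)
              (f' : (AdelicGroupData.gl n K).L2 μ') = c • (f' : (AdelicGroupData.gl n K).L2 μ')))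
  swap
  · exact htw hn h₁ P P' hne hω hS₀ hα₀ hβ₀
  -- the global theorem and the local data
  obtain ⟨C, hC, hT⟩ := exists_entire_eq_mul_partialPairL_mul_setIntegral_pair (n := n) (K := K) hn μ' νI νA νK ν₀
  obtain ⟨m, c, f, f', 𝔫₀, h𝔫₀, η, hη, hηK, S', hS'f, hS₀S', hS', x, y, hx, hy, Φinf, hΦc, hΦ0, hΦS, B, hB,
    hBsum⟩ := hloc hn h₁ P P' hne hω hS₀ hα₀ hβ₀
  have hZ : ∀ (i : Fin m) (z : ideleGroup K), ∃ c : ℂ, ‖c‖ = 1 ∧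
      (AdelicGroupData.gl n K).rightRegular μ' (Matrix.GeneralLinearGroup.scalar (Fin n) z)
          ((f i : P.1.toSubmodule) : (AdelicGroupData.gl n K).L2 μ') =
        c • ((f i : P.1.toSubmodule) : (AdelicGroupData.gl n K).L2 μ') ∧
      (AdelicGroupData.gl n K).rightRegular μ' (Matrix.GeneralLinearGroup.scalar (Fin n) z)
          ((f' i : P'.conj.1.toSubmodule) : (AdelicGroupData.gl n K).L2 μ') =
        c • ((f' i : P'.conj.1.toSubmodule) : (AdelicGroupData.gl n K).L2 μ') := fun i z => by
    obtain ⟨d, hd, hP, hQ⟩ := hω z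
    exact ⟨d, hd, hP (f i), hQ (f' i)⟩
  choose F hF hFI hFstrip hF1 using fun i : Fin m =>
    hT P P'.conj (f i) (f' i) (hZ i) hα₀ hβ₀.conj (h𝔫₀ i) (hη i) (hηK i) (hS₀S' i) (hS' i) (hx i) (hy i)
      (hΦc i) (hΦ0 i) (hΦS i)
  -- the residues of every `F_i` at `s = 1` and `s = 0`
  have hF1' : ∀ i, F i 1 = 0 := fun i => hF1 i h₁ hne
  have hF0' : ∀ i, F i 0 = 0 := fun i =>
    apply_zero_eq_zero_of_entire_eq_mul_rankinSelbergIntegral_of_ne_conj hn h₁ νI P P' hne (f i) (f' i) (hη i)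
      (hΦS i) (hF i) (hFI i)
  -- `∑ c_i F_i = s (s - 1) · C · L^{S₀} · ∑ c_i A_i` on the strip
  have hββ : (fun v => ((β₀ v).map conj).map conj) = β₀ := funext fun v => multiset_map_conj_map_conj _
  have hmul : ∀ (i : Fin m) (s : ℂ), 1 < s.re → Multipliable fun v : {v : HeightOneSpectrum (𝓞 K) // v ∉ S' i} =>
      ((satakePairPolynomial (α₀ v.1) (β₀ v.1)).eval ((v.1.residueCard : ℂ) ^ (-s)))⁻¹ := fun i s hs =>
    JacquetShalika1981_multipliable_partialPairL_holds P P' (hα₀.mono (hS₀S' i)) (hβ₀.mono (hS₀S' i)) hs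
  have hPne : ∀ (i : Fin m) (s : ℂ), 1 < s.re → ∀ v ∈ (hS'f i).toFinset,
      (satakePairPolynomial (α₀ v) (β₀ v)).eval ((v.residueCard : ℂ) ^ (-s)) ≠ 0 := fun i s hs v hv =>
    eval_satakePairPolynomial_ne_zero_of_one_lt_re P P' hα₀ hβ₀ ((hS'f i).mem_toFinset.1 hv).2 hs
  have hsum : ∀ s : ℂ, 1 < s.re → s.re < 2 →
      ∑ i, c i * F i s = (s * (s - 1) * (C : ℂ) * partialPairL S₀ α₀ β₀ s) *
        ∑ i, c i * ((∏ v ∈ (hS'f i).toFinset,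
                (satakePairPolynomial (α₀ v) (β₀ v)).eval ((v.residueCard : ℂ) ^ (-s))) *
              ∫ p in unitBox {v | v ∉ S' i} ×ˢ Set.univ, torusPairIntegrandC n K
                (whittakerCoeff ν₀ (unipotentTateDomain n K) (adeleAddChar K)
                  (invQuot (AdelicGroupData.gl n K) (smoothedForm (η i) ((f i : P.1.toSubmodule) : (AdelicGroupData.gl n K).L2 μ'))))
                (star (whittakerCoeff ν₀ (unipotentTateDomain n K) (adeleAddChar K)
                  (invQuot (AdelicGroupData.gl n K) (smoothedForm (η i) ((f' i : P'.conj.1.toSubmodule) : (AdelicGroupData.gl n K).L2 μ')))))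
                (standardTestFun n K (Φinf i)) s p ∂(νA.prod νK)) := by
    intro s hs1 hs2
    rw [Finset.mul_sum]
    refine Finset.sum_congr rfl fun i _ => ?_
    have h := hFstrip i s hs1 hs2
    beta_reduce at h
    rw [hββ] at h
    have hP0 : (∏ v ∈ (hS'f i).toFinset,
                (satakePairPolynomial (α₀ v) (β₀ v)).eval ((v.residueCard : ℂ) ^ (-s))) ≠ 0 :=
      Finset.prod_ne_zero_iff.2 (hPne i s hs1)
    rw [h, partialPairL_eq_prod_mul_partialPairL (hS₀S' i) (hS'f i) α₀ β₀ (hmul i s hs1), Finset.prod_inv_distrib]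
    field_simp
  -- the entire function `G = C⁻¹ B ∑ c_i F_i`
  set G : ℂ → ℂ := fun s => (C : ℂ)⁻¹ * (B s * ∑ i, c i * F i s) with hGdef
  have hC0 : (C : ℂ) ≠ 0 := Complex.ofReal_ne_zero.2 hC.ne'
  have hsumF : Differentiable ℂ fun s => ∑ i, c i * F i s := by
    have h : Differentiable ℂ (∑ i, fun s => c i * F i s) := Differentiable.sum fun i _ => (hF i).const_mul (c i)
    convert h using 1
    funext s
    simp only [Finset.sum_apply]
  have hG : Differentiable ℂ G := by
    show Differentiable ℂ fun s => (C : ℂ)⁻¹ * (B s * ∑ i, c i * F i s)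
    exact (hB.mul hsumF).const_mul _
  have hGstrip : ∀ s : ℂ, 1 < s.re → s.re < 2 → G s = s * (s - 1) * partialPairL S₀ α₀ β₀ s := by
    intro s hs1 hs2
    have h1 := hBsum s hs1 hs2
    show (C : ℂ)⁻¹ * (B s * ∑ i, c i * F i s) = _
    rw [hsum s hs1 hs2, mul_left_comm (B s), h1, mul_one]
    field_simp
  have hGL : ∀ s : ℂ, 1 < s.re → G s = s * (s - 1) * partialPairL S₀ α₀ β₀ s :=
    eq_mul_partialPairL_of_eqOn_strip P P' hα₀ hβ₀ hG (differentiable_id.mul (differentiable_id.sub_const 1)) hGstrip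
  have hG1 : G 1 = 0 := by
    show (C : ℂ)⁻¹ * (B 1 * ∑ i, c i * F i 1) = 0
    rw [Finset.sum_eq_zero fun i _ => by rw [hF1' i, mul_zero], mul_zero, mul_zero]
  have hG0 : G 0 = 0 := by
    show (C : ℂ)⁻¹ * (B 0 * ∑ i, c i * F i 0) = 0
    rw [Finset.sum_eq_zero fun i _ => by rw [hF0' i, mul_zero], mul_zero, mul_zero]
  exact exists_entire_eq_of_entire_mul_of_apply_eq_zero hG hG0 hG1 hGL

end LocalReduction

end Literature.NumberTheory.Automorphic
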